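import Summits.Parity.BatemanHorn.Theorems.SoloInformedPairWindowLogSqPieces
import Summits.Parity.BatemanHorn.Theorems.SoloInformedMoebiusCoprimeTailLogSq

/-!
# The balanced pair window with the twin weight `μ(d₀)μ(d₁) log²(d₀d₁)` is `o(x)`
# (soloist file, project (F)-kernel, L4b)

Soloist file (informed mode).  The Duke–Friedlander–Iwaniec-range window theorem of
`Literature.NumberTheory.Sieve.LinearPairMoebius.window_pair_sum_isLittleO` (weight `μ log ⊗ μ log`)
for the twin-prime divisor weight `μ(d₀) μ(d₁) log²(d₀d₁)` on a square box: for `q₀, q₁ ≥ 1`,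
`gcd(qᵢ,aᵢ) = 1`, `Δ = q₁a₀ − q₀a₁ ≠ 0`, `5/11 < σ < 1/2` there is `c > 0` with: for all
`0 < θ, η ≤ c`, every `n₀`, every box side `x^{1−σ/2} ≤ B(x) ≤ x²` and count length
`n₀ ≤ X(x) ≤ x` eventually,
`Σ_{d₀, d₁ ≤ B(x)} [x^{1−η} < d₀d₁ ≤ x^{1+θ}][x^σ < dᵢ] μ(d₀)μ(d₁) log²(d₀d₁)
   #{n₀ < n ≤ X(x) : d₀ ∣ q₀n + a₀, d₁ ∣ q₁n + a₁} = o(x)` (the count length `X(x) ≤ x` is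
decoupled from the window scale `x`: the twin kernel uses `X = ⌊x/2⌋` and `⌈x/2⌉`).
Assembly of `abs_main_logsq_le` (Siegel–Walfisz tails with exponent 8, incl. the `log²` tail of
`SoloInformedMoebiusCoprimeTailLogSq`) and `abs_psi_logsq_le` (bilinear Kloosterman bound), exactly as
in the Literature file. [folklore]
-/

namespace Summit.Parity.BatemanHorn.Theorems.PairWindow

open scoped BigOperators ArithmeticFunction.Moebius FourierTransform
open Finset Real Filter Asymptotics
open Literature.NumberTheory.Sieve Literature.NumberTheory.Sieve.LinearPairMoebius
open Literature.NumberTheory.Sieve.LinearCongruencePair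
open Literature.NumberTheory.LFunctions.AFE (saw)

/-- Numerics of the main term: with `L ≥ 1` and `T ≥ 0`,
`1 · (P (4L²) Q)(2 + 2L) 3⁴ S / L⁴ ≤ (P Q 16 · 3⁴ S)/L` when `P Q 3⁴ S = T`. [folklore] -/
theorem main_numerics {P Q S L : ℝ} (hP : 0 ≤ P) (hQ : 0 ≤ Q) (hS : 0 ≤ S) (hL : 1 ≤ L) :
    1 * (P * (4 * L ^ 2) * Q) * (2 + 2 * L) * 3 ^ 4 * S / L ^ 4 ≤ P * Q * 16 * 3 ^ 4 * S / L := by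
  have hL0 : 0 < L := by linarith
  rw [div_le_div_iff₀ (by positivity) hL0]
  have hT : 0 ≤ P * Q * 3 ^ 4 * S := by positivity
  have h34 : L ^ 3 ≤ L ^ 4 := pow_le_pow_right₀ hL (by norm_num)
  have hkey : 4 * L ^ 3 * (2 + 2 * L) ≤ 16 * L ^ 4 := by nlinarith
  calc 1 * (P * (4 * L ^ 2) * Q) * (2 + 2 * L) * 3 ^ 4 * S * L
      = (P * Q * 3 ^ 4 * S) * (4 * L ^ 3 * (2 + 2 * L)) := by ring
    _ ≤ (P * Q * 3 ^ 4 * S) * (16 * L ^ 4) := mul_le_mul_of_nonneg_left hkey hT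
    _ = P * Q * 16 * 3 ^ 4 * S * L ^ 4 := by ring

/-- **The balanced divisor window with the twin weight is `o(x)`** (Duke–Friedlander–Iwaniec
range).  For `q₀, q₁ ≥ 1`, `gcd(qᵢ, aᵢ) = 1`, `Δ = q₁a₀ − q₀a₁ ≠ 0` and `5/11 < σ < 1/2` there is
`c > 0` such that for all `0 < θ, η ≤ c`, every threshold `n₀`, every box side `B` and count
length `X` with `x^{1−σ/2} ≤ B(x) ≤ x²`, `n₀ ≤ X(x) ≤ x` eventually,
`Σ_{d₀, d₁ ≤ B(x)} [x^{1−η} < d₀d₁ ≤ x^{1+θ}][x^σ < d₀][x^σ < d₁] μ(d₀)μ(d₁) log²(d₀d₁)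
   · #{n₀ < n ≤ X(x) : d₀ ∣ q₀n + a₀, d₁ ∣ q₁n + a₁} = o(x)`. [folklore] -/
theorem window_pair_sum_logsq_isLittleO {q₀ q₁ : ℕ} {a₀ a₁ : ℤ} (hq₀ : 0 < q₀) (hq₁ : 0 < q₁)
    (hc₀ : IsCoprime (q₀ : ℤ) a₀) (hc₁ : IsCoprime (q₁ : ℤ) a₁)
    (hΔ : (q₁ : ℤ) * a₀ - (q₀ : ℤ) * a₁ ≠ 0) {σ : ℝ} (hσ : 5 / 11 < σ) (hσ' : σ < 1 / 2) :
    ∃ c : ℝ, 0 < c ∧ ∀ θ η : ℝ, 0 < θ → θ ≤ c → 0 < η → η ≤ c →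
      ∀ (n₀ : ℕ) (B X : ℕ → ℕ),
      (∀ᶠ x : ℕ in atTop, (x : ℝ) ^ (1 - σ / 2) ≤ B x ∧ (B x : ℝ) ≤ (x : ℝ) ^ 2 ∧
        n₀ ≤ X x ∧ X x ≤ x) →
      (fun x : ℕ => ∑ d₀ ∈ Icc 1 (B x), ∑ d₁ ∈ Icc 1 (B x),
        (if ((x : ℝ) ^ (1 - η) < (d₀ : ℝ) * d₁ ∧ (d₀ : ℝ) * d₁ ≤ (x : ℝ) ^ (1 + θ) ∧
              (x : ℝ) ^ σ < (d₀ : ℝ) ∧ (x : ℝ) ^ σ < (d₁ : ℝ)) then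
          (μ d₀ : ℝ) * (μ d₁ : ℝ) * Real.log ((d₀ : ℝ) * d₁) ^ 2 else 0) *
        ((((Ioc n₀ (X x)).filter (fun n : ℕ =>
          (d₀ : ℤ) ∣ (q₀ : ℤ) * n + a₀ ∧ (d₁ : ℤ) ∣ (q₁ : ℤ) * n + a₁)).card : ℕ) : ℝ))
      =o[atTop] fun x : ℕ => (x : ℝ) := by
  classical
  -- constants
  have hg0 : 0 < (11 * σ - 5) / 48 := by linarith
  obtain ⟨Kw, hKw0, hKw⟩ := LinearPairKloosterman.norm_windowSum_le q₀ q₁ a₀ a₁ hq₀ hq₁ hc₀ hc₁ hΔ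
    (ε := (11 * σ - 5) / 48 / 4) (by positivity)
  obtain ⟨C₀, hC₀0, hC₀⟩ := MoebiusCoprimeTail.abs_sum_Ioc_coprime_moebius_div_le
    (B := 8) (by norm_num)
  obtain ⟨C₁, hC₁0, hC₁⟩ := MoebiusCoprimeTail.abs_sum_Ioc_coprime_moebius_mul_log_div_le
    (B := 8) (by norm_num)
  obtain ⟨C₂, hC₂0, hC₂⟩ := abs_sum_Ioc_coprime_moebius_mul_log_sq_div_le (B := 8) (by norm_num)
  refine ⟨(11 * σ - 5) / 48 / 16, by positivity, ?_⟩
  intro θ η hθ hθc hη hηc n₀ B X hB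
  have hσ0 : 0 < σ := by linarith
  -- the solution map
  have hex : ∀ d₀ d₁ : ℕ, ∃ n : ℕ, (0 < d₀ ∧ 0 < d₁ ∧ (Nat.Coprime d₀ q₀ ∧ Nat.Coprime d₁ q₁ ∧
      ((Nat.gcd d₀ d₁ : ℕ) : ℤ) ∣ (q₁ : ℤ) * a₀ - (q₀ : ℤ) * a₁)) →
        (d₀ : ℤ) ∣ (q₀ : ℤ) * n + a₀ ∧ (d₁ : ℤ) ∣ (q₁ : ℤ) * n + a₁ := by
    intro d₀ d₁
    by_cases h : (0 < d₀ ∧ 0 < d₁ ∧ (Nat.Coprime d₀ q₀ ∧ Nat.Coprime d₁ q₁ ∧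
        ((Nat.gcd d₀ d₁ : ℕ) : ℤ) ∣ (q₁ : ℤ) * a₀ - (q₀ : ℤ) * a₁))
    · obtain ⟨hd₀, hd₁, hs⟩ := h
      have hsol := (pair_solvable_iff (d₀ := d₀) (d₁ := d₁) hc₀ hc₁).2
        ⟨Nat.isCoprime_iff_coprime.2 hs.1, Nat.isCoprime_iff_coprime.2 hs.2.1, hs.2.2⟩
      obtain ⟨ν, -, hν₀, hν₁⟩ := exists_nat_sol_lt_lcm hd₀ hd₁ hsol
      exact ⟨ν, fun _ => ⟨hν₀, hν₁⟩⟩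
    · exact ⟨0, fun h' => absurd h' h⟩
  choose ν hν using hex
  have hν' : ∀ d₀ d₁ : ℕ, 0 < d₀ → 0 < d₁ → Nat.Coprime d₀ q₀ → Nat.Coprime d₁ q₁ →
      ((Nat.gcd d₀ d₁ : ℕ) : ℤ) ∣ (q₁ : ℤ) * a₀ - (q₀ : ℤ) * a₁ →
        (d₀ : ℤ) ∣ (q₀ : ℤ) * (ν d₀ d₁) + a₀ ∧ (d₁ : ℤ) ∣ (q₁ : ℤ) * (ν d₀ d₁) + a₁ :=
    fun d₀ d₁ h0 h1 h2 h3 h4 => hν d₀ d₁ ⟨h0, h1, h2, h3, h4⟩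
  -- names
  set Δ : ℤ := (q₁ : ℤ) * a₀ - (q₀ : ℤ) * a₁ with hΔdef
  set D : ℕ := Δ.natAbs with hDdef
  set KM : ℝ := (D.divisors.card : ℝ) * (1 + Real.log D) ^ 2 * (C₀ + C₁ + C₂) *
    (4 : ℝ) ^ q₁.primeFactors.card * 16 * 3 ^ 4 * (2 / σ) ^ (8 : ℝ) with hKMdef
  set CΨ : ℝ := 48400 * Kw + 144 with hCΨdef
  set c : ℝ := (11 * σ - 5) / 48 / 16 with hcdef
  have hc0 : 0 < c := by rw [hcdef]; positivity
  have hexp : η + (1 + θ) * (7 / 8) + (1 + θ - σ) * (11 / 48 + (11 * σ - 5) / 48 / 4) +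
      (11 / 4) * c ≤ 1 - c := exponent_le hσ hσ'.le hθc hηc
  -- eventual conditions
  have hev₁ : ∀ᶠ x : ℕ in atTop, 6 ≤ x := eventually_ge_atTop 6
  have hev₃ : ∀ᶠ x : ℕ in atTop, a₀.natAbs ≤ x := eventually_ge_atTop _
  have hev₄ : ∀ᶠ x : ℕ in atTop, (2 : ℝ) * D ≤ (x : ℝ) ^ σ :=
    ((tendsto_rpow_atTop hσ0).comp tendsto_natCast_atTop_atTop).eventually_ge_atTop _
  have hev₅ : ∀ᶠ x : ℕ in atTop, (D : ℝ) ≤ (x : ℝ) ^ (σ / 2) :=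
    ((tendsto_rpow_atTop (by linarith)).comp tendsto_natCast_atTop_atTop).eventually_ge_atTop _
  -- the bound `|W(x)| ≤ (KM / log x + 8 CΨ (log x)^6 x^{-c}) x`
  refine isLittleO_of_abs_le_mul (g := fun x : ℕ => KM / Real.log x +
    8 * CΨ * (Real.log x ^ 6 * (x : ℝ) ^ (-c))) ?_ ?_
  · filter_upwards [hev₁, hev₃, hev₄, hev₅, hB] with x hx₆ hxa hx₄ hx₅ hBx
    obtain ⟨hB₀, hB₀', hxn, hXx⟩ := hBx
    have hx6 : (6 : ℝ) ≤ x := by exact_mod_cast hx₆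
    have hx0 : (0 : ℝ) < x := by linarith
    have hx1 : (1 : ℝ) ≤ x := by linarith
    have hx₃ : 3 ≤ x := le_trans (by norm_num) hx₆
    have hxa' : |(a₀ : ℝ)| ≤ x := by
      rw [← Int.cast_abs, ← Nat.cast_natAbs]; exact_mod_cast hxa
    have hL1 : 1 ≤ Real.log x := by
      rw [Real.le_log_iff_exp_le hx0]
      have := Real.exp_one_lt_d9; linarith
    -- decomposition
    rw [window_sum_decomp hc₀ hc₁ ν hν' _ (B x) (B x) hxn]
    -- main term
    have hM : |∑ d₀ ∈ Icc 1 (B x), ∑ d₁ ∈ Icc 1 (B x),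
        (if (Nat.Coprime d₀ q₀ ∧ Nat.Coprime d₁ q₁ ∧ ((Nat.gcd d₀ d₁ : ℕ) : ℤ) ∣ Δ) then
          (if ((x : ℝ) ^ (1 - η) < (d₀ : ℝ) * d₁ ∧ (d₀ : ℝ) * d₁ ≤ (x : ℝ) ^ (1 + θ) ∧
              (x : ℝ) ^ σ < (d₀ : ℝ) ∧ (x : ℝ) ^ σ < (d₁ : ℝ)) then
            (μ d₀ : ℝ) * (μ d₁ : ℝ) * Real.log ((d₀ : ℝ) * d₁) ^ 2 else 0) else 0) /
          (Nat.lcm d₀ d₁ : ℕ)| ≤ KM / Real.log x := by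
      refine (abs_main_logsq_le q₀ hq₁ hΔ hC₀0 hC₁0 hC₂0 hC₀ hC₁ hC₂ hσ0 θ η hx₃ hx₄ hx₅ hB₀').trans
        ?_
      have hP : 0 ≤ (D.divisors.card : ℝ) * (1 + Real.log D) ^ 2 * (C₀ + C₁ + C₂) := by
        have : (1 : ℝ) ≤ D := by exact_mod_cast Int.natAbs_pos.2 hΔ
        have : 0 ≤ Real.log D := Real.log_nonneg this
        positivity
      have h := main_numerics hP (by positivity : (0 : ℝ) ≤ (4 : ℝ) ^ q₁.primeFactors.card)
        (by positivity : (0 : ℝ) ≤ (2 / σ) ^ (8 : ℝ)) hL1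
      rw [hKMdef]
      convert h using 2
    -- sawtooth sums
    have hΨ : ∀ y : ℕ, y ≤ x → |∑ d₀ ∈ Icc 1 (B x), ∑ d₁ ∈ Icc 1 (B x),
        (if (Nat.Coprime d₀ q₀ ∧ Nat.Coprime d₁ q₁ ∧ ((Nat.gcd d₀ d₁ : ℕ) : ℤ) ∣ Δ) then
          (if ((x : ℝ) ^ (1 - η) < (d₀ : ℝ) * d₁ ∧ (d₀ : ℝ) * d₁ ≤ (x : ℝ) ^ (1 + θ) ∧
              (x : ℝ) ^ σ < (d₀ : ℝ) ∧ (x : ℝ) ^ σ < (d₁ : ℝ)) then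
            (μ d₀ : ℝ) * (μ d₁ : ℝ) * Real.log ((d₀ : ℝ) * d₁) ^ 2 else 0) else 0) *
          saw (((y : ℝ) - ν d₀ d₁) / (Nat.lcm d₀ d₁ : ℕ))| ≤
        4 * (CΨ * Real.log x ^ 6 * (x : ℝ) ^ (1 - c)) := fun y hy =>
      abs_psi_logsq_le hKw0.le hKw hσ0 (by linarith) hc0 (by rw [hcdef]; nlinarith)
        (by rw [hcdef]; nlinarith) hθ hθc hη hηc hexp hx₆ hxa' hx₄ hB₀ hB₀' ν hν' hy
    have hΨ₁ := hΨ n₀ (hxn.trans hXx)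
    have hΨ₂ := hΨ (X x) hXx
    -- combine
    have hxsub : ((X x - n₀ : ℕ) : ℝ) ≤ x := by exact_mod_cast (Nat.sub_le (X x) n₀).trans hXx
    have hxc : (x : ℝ) ^ (1 - c) = (x : ℝ) ^ (-c) * x := by
      rw [show (1 - c : ℝ) = -c + 1 by ring, Real.rpow_add hx0, Real.rpow_one]
    have hKM0 : 0 ≤ KM := by
      rw [hKMdef]
      have : (1 : ℝ) ≤ D := by exact_mod_cast Int.natAbs_pos.2 hΔ
      have : 0 ≤ Real.log D := Real.log_nonneg this
      positivity
    have hCΨ0 : 0 ≤ CΨ := by rw [hCΨdef]; positivity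
    have hlog0 : 0 < Real.log x := by linarith
    calc |((X x - n₀ : ℕ) : ℝ) * _ + _ - _|
        ≤ |((X x - n₀ : ℕ) : ℝ) * _ + _| + |_| := abs_sub _ _
      _ ≤ |((X x - n₀ : ℕ) : ℝ) * _| + |_| + |_| := by gcongr; exact abs_add_le _ _
      _ ≤ (x : ℝ) * (KM / Real.log x) + 4 * (CΨ * Real.log x ^ 6 * (x : ℝ) ^ (1 - c)) +
          4 * (CΨ * Real.log x ^ 6 * (x : ℝ) ^ (1 - c)) := by
          refine add_le_add (add_le_add ?_ hΨ₁) hΨ₂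
          rw [abs_mul, abs_of_nonneg (Nat.cast_nonneg _)]
          exact mul_le_mul hxsub hM (abs_nonneg _) (Nat.cast_nonneg _)
      _ = (KM / Real.log x + 8 * CΨ * (Real.log x ^ 6 * (x : ℝ) ^ (-c))) * x := by
          rw [hxc]; ring
  · -- the majorant tends to `0`
    have h1 : Tendsto (fun x : ℕ => KM / Real.log x) atTop (nhds 0) := by
      have hlog : Tendsto (fun x : ℕ => Real.log x) atTop atTop :=
        Real.tendsto_log_atTop.comp tendsto_natCast_atTop_atTop
      have h := (tendsto_inv_atTop_zero.comp hlog).const_mul KM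
      rw [mul_zero] at h
      refine h.congr fun x => ?_
      simp only [Function.comp, div_eq_mul_inv]
    have h2 := (tendsto_log_pow_six_mul_rpow_neg hc0).const_mul (8 * CΨ)
    rw [mul_zero] at h2
    have := h1.add h2
    rw [add_zero] at this
    exact this

end Summit.Parity.BatemanHorn.Theorems.PairWindow
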